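import Literature.MathematicalPhysics.QuantumLattice.ClusterProductSlice
import HarnessLib

/-!
# Inter-cluster hops on fermionic product states with even factors

Topic `MathematicalPhysics/QuantumLattice`; continues `ClusterProductStates.lean` / `ClusterProductSlice.lean`.
For the Koszul product state `⊗_c ψ_c` over an ordered cluster partition with EVEN factors (cluster vectors
of even fermion parity — e.g. the `0`-hole and `2`-hole plaquette states of the checkerboard Hubbard model)
the Jordan–Wigner strings of single fermion operators through the lower clusters are invisible on the
factors themselves, and a one-electron hop between two clusters is a product state again, up to ONE sign:

* `annihilation_emb_mulVec_prodFamily_of_even`, `creation_emb_mulVec_prodFamily_of_even` — on even factors,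
  `c_{emb c j}` / `c†_{emb c j}` act on their own factor (the string `(-1)^N` of each lower cluster is `+1`);
* `creation_emb_mul_annihilation_emb_mulVec_prodFamily` — **THE HOP**: for `c₁ ≠ c₂` and even factors,
  `c†_{emb c₁ i} c_{emb c₂ j} (⊗ ψ) = ε · ⊗(ψ; c₁ ↦ c†_i ψ_{c₁}, c₂ ↦ c_j ψ_{c₂})`,
  `ε = −1` if `c₂ < c₁` and `+1` otherwise — after `c_j` the factor `c₂` is odd, and the string of `c†_i`
  through the clusters below `c₁` sees it exactly when `c₂ < c₁`;
* `creation_emb_mul_annihilation_emb_mulVec_prodFamily_eq_sliceMap` — the same written through the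
  two-cluster slice of `ClusterProductSlice`: `= ε · slice_{c₁c₂}(ψ) (c†_i ψ_{c₁} ⊗ c_j ψ_{c₂})`.

This is the fermionic half of the reduction of the inter-plaquette hopping `T = −Σ c†c` acting on the
plaquette product states to two-cluster data (Tsai–Kivelson 2006, App. A; the relative sign between pair
transfer and out-and-back processes, `interClusterKernel`).

Tree: `annihilation_emb_mulVec_prodFamily`, `creation_emb_mulVec_prodFamily` (`ClusterProductStates`),
`parityOp_mulVec_of_hasParity`, `HasParity.annihilation_mulVec` (`TwoClusterFock`), `sliceMap_mulVec_tensorVec`,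
`prodFamily_update_smul'` (`ClusterProductSlice`).

References: O. Bratteli, D. W. Robinson, *Operator Algebras and QSM II* (1997) §5.2.2, eq. (5.2.13)
[BratteliRobinsonII1997]; W.-F. Tsai, S. A. Kivelson, PRB 73 (2006) 214510, App. A (A1)–(A3) [TsaiKivelson2006].
-/

noncomputable section

namespace Literature.MathematicalPhysics.QuantumLattice

open Matrix Finset TwoCluster

namespace ClusterProduct.Partition

variable {ι' C κ : Type*} [LinearOrder ι'] [LinearOrder C] [LinearOrder κ] (P : Partition ι' C κ)
  [Fintype ι'] [Fintype C] [Fintype κ]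

omit [LinearOrder ι'] [LinearOrder C] [Fintype ι'] [Fintype C] P in
/-- The parity operator of `FermionOperators` (appearing in `ClusterProductStates`) on a vector of
definite parity `p` is the scalar `(-1)^p` (bridge to `TwoCluster.parityOp_mulVec_of_hasParity`; the two
`parityOp`s are the same diagonal matrix). [folklore] -/
theorem parityOp_mulVec_eq_of_hasParity {p : ℕ} {x : Fock κ} (hx : HasParity p x) :
    (QuantumLattice.parityOp : Matrix (Finset κ) (Finset κ) ℂ) *ᵥ x = ((-1 : ℂ) ^ p) • x :=
  TwoCluster.parityOp_mulVec_of_hasParity hx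

/-- **On even factors an embedded annihilation operator acts on its own factor only**: the parity
string through every lower cluster is `+1`. [cite: BratteliRobinsonII1997, §5.2.2 eq. (5.2.13)] -/
theorem annihilation_emb_mulVec_prodFamily_of_even {ψ : C → Fock κ} (hψ : ∀ c, HasParity 0 (ψ c))
    (c₀ : C) (j : κ) :
    annihilation (P.emb c₀ j) *ᵥ P.prodFamily ψ =
      P.prodFamily (Function.update ψ c₀ (annihilation j *ᵥ ψ c₀)) := by
  rw [P.annihilation_emb_mulVec_prodFamily c₀ j ψ]
  congr 1
  funext c
  by_cases hc : c < c₀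
  · rw [if_pos hc, parityOp_mulVec_eq_of_hasParity (hψ c), pow_zero, one_smul,
      Function.update_of_ne (ne_of_lt hc)]
  · rw [if_neg hc]

/-- **On even factors an embedded creation operator acts on its own factor only.**
[cite: BratteliRobinsonII1997, §5.2.2 eq. (5.2.13)] -/
theorem creation_emb_mulVec_prodFamily_of_even {ψ : C → Fock κ} (hψ : ∀ c, HasParity 0 (ψ c))
    (c₀ : C) (j : κ) :
    creation (P.emb c₀ j) *ᵥ P.prodFamily ψ =
      P.prodFamily (Function.update ψ c₀ (creation j *ᵥ ψ c₀)) := by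
  rw [P.creation_emb_mulVec_prodFamily c₀ j ψ]
  congr 1
  funext c
  by_cases hc : c < c₀
  · rw [if_pos hc, parityOp_mulVec_eq_of_hasParity (hψ c), pow_zero, one_smul,
      Function.update_of_ne (ne_of_lt hc)]
  · rw [if_neg hc]

/-- **A one-electron hop between two clusters of a product state with even factors.** For `c₁ ≠ c₂`,
`c†_{emb c₁ i} c_{emb c₂ j} (⊗ ψ) = ε · ⊗(ψ; c₁ ↦ c†_i ψ_{c₁}, c₂ ↦ c_j ψ_{c₂})` with `ε = −1` if
`c₂ < c₁` and `ε = +1` otherwise: the annihilation makes the factor `c₂` odd, and the Jordan–Wigner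
string of the creation operator through the clusters below `c₁` picks up its parity exactly when
`c₂ < c₁`. [cite: BratteliRobinsonII1997, §5.2.2 eq. (5.2.13)] -/
theorem creation_emb_mul_annihilation_emb_mulVec_prodFamily {ψ : C → Fock κ} (hψ : ∀ c, HasParity 0 (ψ c))
    {c₁ c₂ : C} (h : c₁ ≠ c₂) (i j : κ) :
    (creation (P.emb c₁ i) * annihilation (P.emb c₂ j)) *ᵥ P.prodFamily ψ =
      (if c₂ < c₁ then (-1 : ℂ) else 1) •
        P.prodFamily (Function.update (Function.update ψ c₁ (creation i *ᵥ ψ c₁)) c₂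
          (annihilation j *ᵥ ψ c₂)) := by
  rw [← mulVec_mulVec, P.annihilation_emb_mulVec_prodFamily_of_even hψ c₂ j,
    P.creation_emb_mulVec_prodFamily c₁ i]
  set ψ₁ : C → Fock κ := Function.update ψ c₂ (annihilation j *ᵥ ψ c₂) with hψ₁
  have hψ₁c₁ : ψ₁ c₁ = ψ c₁ := by rw [hψ₁, Function.update_of_ne h]
  have hψ₁c₂ : ψ₁ c₂ = annihilation j *ᵥ ψ c₂ := by rw [hψ₁, Function.update_self]
  have hodd : HasParity 1 (ψ₁ c₂) := by rw [hψ₁c₂]; exact (hψ c₂).annihilation_mulVec j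
  -- the transformed family is `ψ` with `c†_i` at `c₁` and `± c_j` at `c₂`
  have hfam : (fun c => if c < c₁ then parityOp *ᵥ ψ₁ c else
        Function.update ψ₁ c₁ (creation i *ᵥ ψ₁ c₁) c) =
      Function.update (Function.update ψ c₁ (creation i *ᵥ ψ c₁)) c₂
        ((if c₂ < c₁ then (-1 : ℂ) else 1) • (annihilation j *ᵥ ψ c₂)) := by
    funext c
    by_cases hc₂ : c = c₂
    · subst hc₂
      rw [Function.update_self]
      by_cases hlt : c < c₁
      · rw [if_pos hlt, if_pos hlt, parityOp_mulVec_eq_of_hasParity hodd, pow_one, hψ₁c₂]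
      · rw [if_neg hlt, if_neg hlt, one_smul, Function.update_of_ne (Ne.symm h), hψ₁c₂]
    · rw [Function.update_of_ne hc₂]
      by_cases hc₁ : c = c₁
      · subst hc₁
        rw [if_neg (lt_irrefl _), Function.update_self, Function.update_self, hψ₁c₁]
      · rw [Function.update_of_ne hc₁]
        have hψ₁c : ψ₁ c = ψ c := by rw [hψ₁, Function.update_of_ne hc₂]
        by_cases hlt : c < c₁
        · rw [if_pos hlt, hψ₁c, parityOp_mulVec_eq_of_hasParity (hψ c), pow_zero, one_smul,
            Function.update_of_ne hc₁]
        · rw [if_neg hlt, Function.update_of_ne hc₁, hψ₁c]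
  rw [hfam, P.prodFamily_update_smul']

/-- The hop written through the two-cluster slice of `ClusterProductSlice`:
`c†_{emb c₁ i} c_{emb c₂ j} (⊗ ψ) = ε · slice_{c₁c₂}(ψ) (c†_i ψ_{c₁} ⊗ c_j ψ_{c₂})`.
[cite: TsaiKivelson2006, App. A (A1)] -/
theorem creation_emb_mul_annihilation_emb_mulVec_prodFamily_eq_sliceMap {ψ : C → Fock κ}
    (hψ : ∀ c, HasParity 0 (ψ c)) {c₁ c₂ : C} (h : c₁ ≠ c₂) (i j : κ) :
    (creation (P.emb c₁ i) * annihilation (P.emb c₂ j)) *ᵥ P.prodFamily ψ =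
      (if c₂ < c₁ then (-1 : ℂ) else 1) •
        (P.sliceMap ψ c₁ c₂ *ᵥ tensorVec (creation i *ᵥ ψ c₁) (annihilation j *ᵥ ψ c₂)) := by
  rw [P.creation_emb_mul_annihilation_emb_mulVec_prodFamily hψ h, P.sliceMap_mulVec_tensorVec h]

/-- The hop in the opposite direction, written through the SAME slice `(c₁, c₂)`:
`c†_{emb c₂ j} c_{emb c₁ i} (⊗ ψ) = ε' · slice_{c₁c₂}(ψ) (c_i ψ_{c₁} ⊗ c†_j ψ_{c₂})`, `ε' = −1` if `c₁ < c₂`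
else `+1`. [cite: TsaiKivelson2006, App. A (A1)] -/
theorem creation_emb_mul_annihilation_emb_mulVec_prodFamily_eq_sliceMap' {ψ : C → Fock κ}
    (hψ : ∀ c, HasParity 0 (ψ c)) {c₁ c₂ : C} (h : c₁ ≠ c₂) (i j : κ) :
    (creation (P.emb c₂ j) * annihilation (P.emb c₁ i)) *ᵥ P.prodFamily ψ =
      (if c₁ < c₂ then (-1 : ℂ) else 1) •
        (P.sliceMap ψ c₁ c₂ *ᵥ tensorVec (annihilation i *ᵥ ψ c₁) (creation j *ᵥ ψ c₂)) := by
  rw [P.creation_emb_mul_annihilation_emb_mulVec_prodFamily hψ (Ne.symm h), P.sliceMap_mulVec_tensorVec h,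
    Function.update_comm h]

end ClusterProduct.Partition

end Literature.MathematicalPhysics.QuantumLattice

end
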